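import Summits.CriticalPhenomena.CardyFormulaZ2.Theses.CardySelfRefinement
import Summits.CriticalPhenomena.CardyFormulaZ2.Theorems.CardySelfRefinementLagsToInvariance
import Literature.Probability.Percolation.QuadCrossingSpaceZ2
import HarnessLib

/-!
# Stub C of line `Sketch` for the crux `ScaleInvariantLimits` (stmt-CriticalPhenomena-10265)

**Lag merging for every `k > 1` ⇒ every subsequential limit is `S_t`-invariant for all `t > 0`.**

If, for every lag `k > 1` and every finite family of quads `G`, the full-plane quad-crossing laws
`squareCrossingLaw univ (kη)` and `squareCrossingLaw univ η` of critical bond percolation on `ℤ²`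
give asymptotically (`η → 0⁺`) the same mass to the joint crossing event `{S | ∀ i, G i ∈ S}`,
then every subsequential scaling limit `μ ∈ subseqQuadLimits univ` satisfies
`dilateLaw t μ = μ` for every `t > 0` (`stub_scaleInvariantLimits_of_lags`).

Proof.  For `t > 1` this is exactly the landed `Theorems.dilateLaw_eq_self_of_lags`
(`CardySelfRefinementLagsToInvariance.lean`); `t = 1` is `S_1 = id`; for `t < 1` apply the landed
lemma to `t⁻¹ > 1` and use `S_t S_{t⁻¹} = S_1 = id`.  The group bookkeeping `S_1 = id`,
`S_s S_t = S_{st}` on laws (`dilateLaw_one_eq`, `dilateLaw_dilateLaw_eq`, `dilateLaw_congr_scale`)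
is adapted from the crux disprover's `Cruxes/ScaleInvariantLimits/Disproof.lean` §1.
-/

noncomputable section

open MeasureTheory Filter Set Topology
open Literature.Probability.Percolation Literature.Probability.Percolation.QuadCrossing

namespace Summit.CriticalPhenomena.CardyFormulaZ2.Theorems

/-! ### Group bookkeeping for the dilations of laws -/

-- adapted from Cruxes/ScaleInvariantLimits/Disproof.lean §1 (`dilateLaw_congr`,
-- `dilateLaw_dilateLaw`, `dilateLaw_one`)

/-- Proof-irrelevant congruence in the scale parameter: `S_s = S_t` on laws when `s = t`. -/
theorem dilateLaw_congr_scale {s t : ℝ} (hs : s ≠ 0) (ht : t ≠ 0) (h : s = t)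
    (μ : FiniteMeasure (QuadConfig (univ : Set ℂ))) : dilateLaw s hs μ = dilateLaw t ht μ := by
  subst h; rfl

/-- `S_s S_t = S_{st}` on laws. -/
theorem dilateLaw_dilateLaw_eq (s t : ℝ) (hs : s ≠ 0) (ht : t ≠ 0)
    (μ : FiniteMeasure (QuadConfig (univ : Set ℂ))) :
    dilateLaw s hs (dilateLaw t ht μ) = dilateLaw (s * t) (mul_ne_zero hs ht) μ := by
  apply FiniteMeasure.toMeasure_injective
  rw [dilateLaw, dilateLaw, dilateLaw, FiniteMeasure.toMeasure_map, FiniteMeasure.toMeasure_map,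
    FiniteMeasure.toMeasure_map,
    Measure.map_map (QuadConfig.measurable_dilate s hs) (QuadConfig.measurable_dilate t ht)]
  congr 1
  funext S
  exact QuadConfig.dilate_dilate s t hs ht S

/-- `S_1 = id` on laws. -/
theorem dilateLaw_one_eq (μ : FiniteMeasure (QuadConfig (univ : Set ℂ))) :
    dilateLaw 1 one_ne_zero μ = μ := by
  apply FiniteMeasure.toMeasure_injective
  rw [dilateLaw, FiniteMeasure.toMeasure_map]
  have : (QuadConfig.dilate 1 one_ne_zero : QuadConfig (univ : Set ℂ) → _) = id :=
    funext QuadConfig.dilate_one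
  rw [this, Measure.map_id]

/-! ### Stub C: lag merging for all `k > 1` gives `S_t`-invariance for all `t > 0` -/

/-- **Stub C of line `Sketch` (crux `ScaleInvariantLimits`).**  If for every lag `k > 1` and
every finite family of quads `G` the laws `squareCrossingLaw univ (kη)` and
`squareCrossingLaw univ η` merge on the joint crossing event `{S | ∀ i, G i ∈ S}` as `η → 0⁺`,
then every subsequential limit `μ ∈ subseqQuadLimits univ` is invariant under every dilation
`S_t`, `t > 0`: `t > 1` is `dilateLaw_eq_self_of_lags`, `t = 1` is `S_1 = id`, and `t < 1`
follows from `t⁻¹ > 1` and `S_t S_{t⁻¹} = S_1`. -/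
theorem stub_scaleInvariantLimits_of_lags
    (hlags : ∀ k : ℝ, 1 < k → ∀ (m : ℕ) (G : Fin m → Quad (univ : Set ℂ)),
      Tendsto (fun η : ℝ =>
        (squareCrossingLaw (univ : Set ℂ) (k * η) : Measure (QuadConfig (univ : Set ℂ))).real
            {S | ∀ i, G i ∈ S} -
          (squareCrossingLaw (univ : Set ℂ) η : Measure (QuadConfig (univ : Set ℂ))).real
            {S | ∀ i, G i ∈ S}) (𝓝[>] 0) (𝓝 0))
    (μ : FiniteMeasure (QuadConfig (univ : Set ℂ))) (hμ : μ ∈ subseqQuadLimits (univ : Set ℂ))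
    (t : ℝ) (ht : 0 < t) :
    dilateLaw t ht.ne' μ = μ := by
  rcases lt_trichotomy t 1 with h1 | rfl | h1
  · -- `t < 1`: invariance under `S_{t⁻¹}` (`t⁻¹ > 1`) and `S_t S_{t⁻¹} = S_1 = id`
    have hinv : 1 < t⁻¹ := (one_lt_inv₀ ht).2 h1
    have hfix : dilateLaw t⁻¹ (inv_pos.mpr ht).ne' μ = μ :=
      dilateLaw_eq_self_of_lags (inv_pos.mpr ht) (hlags t⁻¹ hinv) hμ
    calc dilateLaw t ht.ne' μ
        = dilateLaw t ht.ne' (dilateLaw t⁻¹ (inv_pos.mpr ht).ne' μ) := by rw [hfix]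
      _ = dilateLaw (t * t⁻¹) (mul_ne_zero ht.ne' (inv_pos.mpr ht).ne') μ :=
          dilateLaw_dilateLaw_eq t t⁻¹ _ _ μ
      _ = dilateLaw 1 one_ne_zero μ := dilateLaw_congr_scale _ _ (mul_inv_cancel₀ ht.ne') μ
      _ = μ := dilateLaw_one_eq μ
  · -- `t = 1`: `S_1 = id`
    exact dilateLaw_one_eq μ
  · -- `1 < t`: the landed lags-to-invariance lemma
    exact dilateLaw_eq_self_of_lags ht (hlags t h1) hμ

end Summit.CriticalPhenomena.CardyFormulaZ2.Theorems

end
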